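import Literature.MathematicalPhysics.QuantumFieldTheory.ConformalBootstrap3D.PointKernelK57Data

/-!
# K57 certificate, kernel block file H9: head segments `54 ≤ i < 60` (block-checked ones)

`decide` by kernel reduction (no `native_decide`, no extra axioms) of the block checker
`PCert.hBlockOK` of `PointKernel` on the literal data of `PointKernelK57Data` (cells checked corner
or chord by the rule bit); soundness is `PCert.hBlockOK_sound`.  Estimated kernel time 177 s
(4 theorems).
-/

set_option maxRecDepth 100000
set_option maxHeartbeats 0

namespace Literature.MathematicalPhysics.QuantumFieldTheory.ConformalBootstrap3D.PointKernelK57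

open Literature.MathematicalPhysics.QuantumFieldTheory.ConformalBootstrap3D.PointKernel

/-- head segment `[54, 55)` passes the kernel evaluator (≈41 s of kernel work). [folklore] -/
theorem hBlock_54 : certK57.hBlockOK hsegsK57 54 55 JHK57 = true := by
  decide +kernel

/-- head segment `[55, 56)` passes the kernel evaluator (≈35 s of kernel work). [folklore] -/
theorem hBlock_55 : certK57.hBlockOK hsegsK57 55 56 JHK57 = true := by
  decide +kernel

/-- head segments `[56, 58)` pass the kernel evaluator (≈47 s of kernel work). [folklore] -/
theorem hBlock_56 : certK57.hBlockOK hsegsK57 56 58 JHK57 = true := by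
  decide +kernel

/-- head segments `[58, 60)` pass the kernel evaluator (≈46 s of kernel work). [folklore] -/
theorem hBlock_58 : certK57.hBlockOK hsegsK57 58 60 JHK57 = true := by
  decide +kernel

end Literature.MathematicalPhysics.QuantumFieldTheory.ConformalBootstrap3D.PointKernelK57
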